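import Summits.Ventures.Crystal3D.Theorems.StickyWulffConstantTextureLiminfTexShadowCoverageBarlowSteer2WideRepDefs
import Summits.Ventures.Crystal3D.Theorems.StickyWulffConstantTextureLiminfTexShadowCoverageBarlowSteer2WideGlue
import Summits.Ventures.Crystal3D.Theorems.StickyWulffConstantTextureLiminfTexShadowReindex
import Summits.Ventures.Crystal3D.Theorems.StickyWulffConstantTextureLiminfTexShadowSteepPlateTwin
import Summits.Ventures.Crystal3D.Theorems.StickyWulffConstantTextureLiminfTexShadowSteepPlateCorner
import HarnessLib

/-!
# TexShadow row (e) / EDGE-ON: the REPRESENTED two-sided wide-steered menu — cell glue, the v8.8 re-cut `edgeOnS_of_repCut`, and «no plate is steep in both presentations»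
# (lane T, crux `TextureLiminfV5`, stmt-Ventures-23912, sub-crux EDGE-ON; cf-p1 DECISION (clxviii)(1)(b)(c) 2026-08-29T08:23:14Z; geometry = 19480-p1 g15's corollary)

HONEST FRAMING. Venture `Summits/Ventures/Crystal3D` (cell `crystal3d-full`), route `route-Ventures-StickyWulffConstant`, helper
`--supports` the law-v5 crux `TextureLiminfV5` (stmt-Ventures-23912), registered line `TexShadow` (v8.7 → v8.8 re-cut `stub_edgeOnRep`).
PROOFS ONLY, by composition BY NAME of landed cells; NO certificate is asserted; nothing about F-C1 is moved.

CONTENTS.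
* **`bilayerWallAt_of_barlowMenuSteer2WideRepCertified`** — a pair certified over the two-sided wide-steered menu in ANY of the four presentation pairs
  `(L₁ | twinRepFrame L₁) × (L₂ | twinRepFrame L₂)` (`BarlowMenuSteer2WideRepCertified`, `…Steer2WideRepDefs`) satisfies the cell inequality at the SAME
  constant `max (max C C′) C″` of p706064 (`R₀ ≥ 6`): the p706064 cell in the certified presentation at the constant table `c₀`, transported back by
  `bilayerWallAt_of_represented₁/₂` (p695488) along `stacking_twinRep`;
* `faultedOnAt_of_steer2WideRepCoverageBarlowOn` — a represented certificate on `Reg` gives the on-`Reg` law; identity certificate;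
* **`edgeOnS_of_repCut`** — THE v8.8 RE-CUT: `P5Exhaustion → StarPairFar → (∃ C, …CoreOnAt (EdgeOnAt (13/25) ∧ ¬BarlowMenuSteer2WideRepCertified (13/25))
  (13/25) C 10) → ∃ C, …CoreOnAt (EdgeOnAt (13/25) ∧ ¬BarlowMenuSteer2WideCertified (13/25)) (13/25) C 10` (so `stub_edgeOnS := edgeOnS_of_repCut stub_E1
  stub_starPairFar stub_edgeOnRep`), its `ExactOnly`/general-`(c₀, R₀)` forms, the same re-cut for the read holes, the frozen `stub_edgeOn` from the
  represented stub (`edgeOn_of_repCut`), the full semantic cut over the represented menu, and the monotonicity `residualFaultedCoreOnAt_edgeOnRep_of_edgeOnS`;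
* **`not_steepPlateAt_rep`** — THE GEOMETRY (19480-p1 g15's `not_steepPlateAt_twin_of_steepPlateAt`, `…SteepPlateTwin`, via `twinRepFrame_eq_twinPresentation`): if `steerSteepCos c ≤ 1/2`
  (e.g. the chord of record `1/3`) then for every unit `e` a plate is NOT steep toward `e` in at least one of its two presentations `L`, `twinRepFrame L`
  (the twin presentation's reference up-slots read toward `e` are the capper directions: `upFrame_twinRepFrame_apply`).  No hemisphere hypothesis is
  needed: `SteepPlateAt` reads through the up-presentation.
WHAT THIS IS NOT: no certificate (`stub_edgeOnRep` stays OPEN: flux-sum shortfalls and reading / non-separated chain frames in all four presentation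
pairs are not priced here); F-C1 not moved.
-/

noncomputable section

open scoped BigOperators InnerProductSpace ENNReal
open MeasureTheory Filter

namespace Summit.Ventures.Crystal3D.Cruxes.TextureLiminf.TexShadow

open Summit.Ventures.Crystal3D Summit.Ventures.Crystal3D.Theorems
open Literature.MathematicalPhysics.StatisticalMechanics (IsHaggSeq fccStacking barlowStacking basalMirror)

/-! ## The cell for a represented-menu-certified pair -/

/-- **Represented-menu-certified ⇒ the cell** at the constant `max (max C C′) C″` of p706064 (`R₀ ≥ 6`), for every table `0 ≤ c ≤ c₀`. -/
theorem bilayerWallAt_of_barlowMenuSteer2WideRepCertified {sE : E3} (hsE : sE ∈ fccSlots)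
    (hcert : ExactOnly 0 (fccSlots.filter fun w => 0 < ⟪w, sE⟫_ℝ))
    (hDS : ∀ F₁ F₂ : E3 ≃ₗᵢ[ℝ] E3, DoubleStarCoaxialAt F₁ F₂) (hCP : CapPairCoaxial)
    {σ₁ σ₂ : ℤ → ℤ} (hσ₁ : IsHaggSeq σ₁) (hσ₂ : IsHaggSeq σ₂) (L₁ L₂ : E3 ≃ₗᵢ[ℝ] E3) (s₁ s₂ : E3)
    {c₀ : ℝ} (hcov : BarlowMenuSteer2WideRepCertified c₀ σ₁ σ₂ L₁ L₂) (R₀ : ℝ) (hR₀ : 6 ≤ R₀)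
    (c : ℤ → ℤ → ℝ) (hc0 : ∀ i j, 0 ≤ c i j) (hcc : ∀ i j, c i j ≤ c₀) :
    BilayerWallAt (max (max ((318 + 192 * R₀ + 80 * (R₀ + 9) + 3456 + 1152 * (R₀ + 1)) / 2)
      (((270 + 576 * R₀) + 80 * (R₀ + 9) + 3456 + 1152 * (R₀ + 1)) / 2))
      (((432 + 1728 * R₀) + 80 * (R₀ + 9) + 3456 + 1152 * (R₀ + 1)) / 2)) R₀ σ₁ σ₂ L₁ L₂ s₁ s₂ c := by
  have hR₀0 : (0 : ℝ) ≤ R₀ := by linarith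
  have hc₀ : (0 : ℝ) ≤ c₀ := (hc0 0 0).trans (hcc 0 0)
  -- the cell in any presentation pair, at the constant table `c₀`
  have cell : ∀ {τ₁ τ₂ : ℤ → ℤ}, IsHaggSeq τ₁ → IsHaggSeq τ₂ → ∀ F₁ F₂ : E3 ≃ₗᵢ[ℝ] E3,
      BarlowMenuSteer2WideCertified c₀ τ₁ τ₂ F₁ F₂ →
        BilayerWallAt (max (max ((318 + 192 * R₀ + 80 * (R₀ + 9) + 3456 + 1152 * (R₀ + 1)) / 2)
          (((270 + 576 * R₀) + 80 * (R₀ + 9) + 3456 + 1152 * (R₀ + 1)) / 2))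
          (((432 + 1728 * R₀) + 80 * (R₀ + 9) + 3456 + 1152 * (R₀ + 1)) / 2)) R₀ τ₁ τ₂ F₁ F₂ s₁ s₂ (fun _ _ => c₀) :=
    fun hτ₁ hτ₂ F₁ F₂ h => bilayerWallAt_of_barlowMenuSteer2WideCertified hsE hcert hDS hCP hτ₁ hτ₂ F₁ F₂ s₁ s₂ h R₀ hR₀
      (fun _ _ => c₀) (fun _ _ => hc₀) (fun _ _ => le_rfl)
  rcases hcov with h | h | h | h
  · exact bilayerWallAt_of_barlowMenuSteer2WideCertified hsE hcert hDS hCP hσ₁ hσ₂ L₁ L₂ s₁ s₂ h R₀ hR₀ c hc0 hcc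
  · exact bilayerWallAt_of_represented₁ hR₀0 (stacking_twinRep L₁ s₁ σ₁) (cell (isHaggSeq_negWord hσ₁) hσ₂ _ _ h) hc0 hcc
  · exact bilayerWallAt_of_represented₂ hR₀0 (stacking_twinRep L₂ s₂ σ₂) (cell hσ₁ (isHaggSeq_negWord hσ₂) _ _ h) hc0 hcc
  · have h₂ := bilayerWallAt_of_represented₂ hR₀0 (stacking_twinRep L₂ s₂ σ₂)
      (cell (isHaggSeq_negWord hσ₁) (isHaggSeq_negWord hσ₂) _ _ h) (c := fun _ _ => c₀) (fun _ _ => hc₀) (fun _ _ => le_rfl)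
    exact bilayerWallAt_of_represented₁ hR₀0 (stacking_twinRep L₁ s₁ σ₁) h₂ hc0 hcc

/-! ## Represented certificate on `Reg` ⇒ the on-`Reg` law -/

/-- **Represented certificate on `Reg` ⇒ `BilayerWallFaultedOnAt Reg c₀ (max (max C C′) C″) R₀`** (`R₀ ≥ 6`). -/
theorem faultedOnAt_of_steer2WideRepCoverageBarlowOn {sE : E3} (hsE : sE ∈ fccSlots)
    (hcert : ExactOnly 0 (fccSlots.filter fun w => 0 < ⟪w, sE⟫_ℝ))
    (hDS : ∀ F₁ F₂ : E3 ≃ₗᵢ[ℝ] E3, DoubleStarCoaxialAt F₁ F₂) (hCP : CapPairCoaxial)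
    {Reg : (ℤ → ℤ) → (ℤ → ℤ) → (E3 ≃ₗᵢ[ℝ] E3) → (E3 ≃ₗᵢ[ℝ] E3) → Prop} {c₀ : ℝ}
    (hcov : ResidualSteer2WideRepCoverageBarlowOn Reg c₀) {R₀ : ℝ} (hR₀ : 6 ≤ R₀) :
    BilayerWallFaultedOnAt Reg c₀ (max (max ((318 + 192 * R₀ + 80 * (R₀ + 9) + 3456 + 1152 * (R₀ + 1)) / 2)
      (((270 + 576 * R₀) + 80 * (R₀ + 9) + 3456 + 1152 * (R₀ + 1)) / 2))
      (((432 + 1728 * R₀) + 80 * (R₀ + 9) + 3456 + 1152 * (R₀ + 1)) / 2)) R₀ := by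
  intro σ₁ σ₂ hσ₁ hσ₂ hf L₁ L₂ s₁ s₂ A₁ A₂ u₁ u₂ _ _ hreg c m hadm
  exact bilayerWallAt_of_barlowMenuSteer2WideRepCertified hsE hcert hDS hCP hσ₁ hσ₂ L₁ L₂ s₁ s₂ (hcov σ₁ σ₂ hσ₁ hσ₂ hf L₁ L₂ hreg)
    R₀ hR₀ c hadm.1 hadm.2.1

/-! ## The v8.8 re-cut: the core on `EdgeOnAt ∧ ¬RepCert` gives the core on `EdgeOnAt ∧ ¬Cert₂` (and the same for the read holes) -/

/-- **Re-cut of an on-region core by the represented menu, `ExactOnly` form** (`R₀ ≥ 6`): for any region `Q`, the core on `Q ∧ ¬RepCert c₀` gives the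
core on `Q ∧ ¬Cert₂ c₀` — the pairs certified in some presentation pair are closed by `faultedOnAt_of_steer2WideRepCoverageBarlowOn` (identity
certificate). -/
theorem residualFaultedCoreOnAt_of_repCut {sE : E3} (hsE : sE ∈ fccSlots)
    (hcert : ExactOnly 0 (fccSlots.filter fun w => 0 < ⟪w, sE⟫_ℝ))
    (hDS : ∀ F₁ F₂ : E3 ≃ₗᵢ[ℝ] E3, DoubleStarCoaxialAt F₁ F₂) (hCP : CapPairCoaxial) {c₀ R₀ : ℝ} (hR₀ : 6 ≤ R₀)
    (Q : (ℤ → ℤ) → (ℤ → ℤ) → (E3 ≃ₗᵢ[ℝ] E3) → (E3 ≃ₗᵢ[ℝ] E3) → Prop)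
    (h : ∃ C : ℝ, BilayerWallResidualFaultedCoreOnAt
      (fun σ₁ σ₂ L₁ L₂ => Q σ₁ σ₂ L₁ L₂ ∧ ¬ BarlowMenuSteer2WideRepCertified c₀ σ₁ σ₂ L₁ L₂) c₀ C R₀) :
    ∃ C : ℝ, BilayerWallResidualFaultedCoreOnAt
      (fun σ₁ σ₂ L₁ L₂ => Q σ₁ σ₂ L₁ L₂ ∧ ¬ BarlowMenuSteer2WideCertified c₀ σ₁ σ₂ L₁ L₂) c₀ C R₀ := by
  obtain ⟨C, hC⟩ := h
  exact ⟨_, residualFaultedCoreOnAt_of_faultedOnAt_union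
    (P := fun σ₁ σ₂ L₁ L₂ => Q σ₁ σ₂ L₁ L₂ ∧ ¬ BarlowMenuSteer2WideCertified c₀ σ₁ σ₂ L₁ L₂)
    (Reg := BarlowMenuSteer2WideRepCertified c₀)
    (Rem := fun σ₁ σ₂ L₁ L₂ => Q σ₁ σ₂ L₁ L₂ ∧ ¬ BarlowMenuSteer2WideRepCertified c₀ σ₁ σ₂ L₁ L₂)
    (fun σ₁ σ₂ L₁ L₂ hQ => by
      by_cases hc : BarlowMenuSteer2WideRepCertified c₀ σ₁ σ₂ L₁ L₂
      · exact Or.inl hc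
      · exact Or.inr ⟨hQ.1, hc⟩)
    (by linarith) (faultedOnAt_of_steer2WideRepCoverageBarlowOn hsE hcert hDS hCP (steer2WideRepCoverageBarlowOn_certified c₀) hR₀) hC⟩

/-- **Re-cut, named-fact form** (`R₀ ≥ 6`). -/
theorem residualFaultedCoreOnAt_of_repCut' (hE1 : P5Exhaustion) (hSP : StarPairFar) {c₀ R₀ : ℝ} (hR₀ : 6 ≤ R₀)
    (Q : (ℤ → ℤ) → (ℤ → ℤ) → (E3 ≃ₗᵢ[ℝ] E3) → (E3 ≃ₗᵢ[ℝ] E3) → Prop)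
    (h : ∃ C : ℝ, BilayerWallResidualFaultedCoreOnAt
      (fun σ₁ σ₂ L₁ L₂ => Q σ₁ σ₂ L₁ L₂ ∧ ¬ BarlowMenuSteer2WideRepCertified c₀ σ₁ σ₂ L₁ L₂) c₀ C R₀) :
    ∃ C : ℝ, BilayerWallResidualFaultedCoreOnAt
      (fun σ₁ σ₂ L₁ L₂ => Q σ₁ σ₂ L₁ L₂ ∧ ¬ BarlowMenuSteer2WideCertified c₀ σ₁ σ₂ L₁ L₂) c₀ C R₀ := by
  obtain ⟨sE, hsE, hcert⟩ := exactOnly_star_of_p5Exhaustion hE1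
  exact residualFaultedCoreOnAt_of_repCut hsE hcert (doubleStarCoaxialAt_of_starPairFar hSP) (capPairCoaxial_of_starPairFar hSP) hR₀ Q h

/-- **`edgeOnS_of_repCut` — THE v8.8 RE-CUT OF THE EDGE-ON CORE** (cf-p1 (clxviii)(2)):
`P5Exhaustion → StarPairFar → (∃ C, …CoreOnAt (EdgeOnAt (13/25) ∧ ¬BarlowMenuSteer2WideRepCertified (13/25)) (13/25) C 10) →
∃ C, …CoreOnAt (EdgeOnAt (13/25) ∧ ¬BarlowMenuSteer2WideCertified (13/25)) (13/25) C 10`.  So `stub_edgeOnS := edgeOnS_of_repCut stub_E1 stub_starPairFar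
stub_edgeOnRep`. -/
theorem edgeOnS_of_repCut (hE1 : P5Exhaustion) (hSP : StarPairFar)
    (hrep : ∃ C : ℝ, BilayerWallResidualFaultedCoreOnAt
      (fun σ₁ σ₂ L₁ L₂ => EdgeOnAt (13 / 25) σ₁ σ₂ L₁ L₂ ∧ ¬ BarlowMenuSteer2WideRepCertified (13 / 25) σ₁ σ₂ L₁ L₂) (13 / 25) C 10) :
    ∃ C : ℝ, BilayerWallResidualFaultedCoreOnAt
      (fun σ₁ σ₂ L₁ L₂ => EdgeOnAt (13 / 25) σ₁ σ₂ L₁ L₂ ∧ ¬ BarlowMenuSteer2WideCertified (13 / 25) σ₁ σ₂ L₁ L₂) (13 / 25) C 10 :=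
  residualFaultedCoreOnAt_of_repCut' hE1 hSP (by norm_num) (EdgeOnAt (13 / 25)) hrep

/-- **The read holes re-cut the same way**: `P5Exhaustion → StarPairFar → (∃ C, …CoreOnAt (¬EdgeOnAt (13/25) ∧ ¬RepCert (13/25)) (13/25) C 10) →
∃ C, …CoreOnAt (¬EdgeOnAt (13/25) ∧ ¬BarlowMenuSteer2WideCertified (13/25)) (13/25) C 10`. -/
theorem readHoles₂_of_repCut (hE1 : P5Exhaustion) (hSP : StarPairFar)
    (hrep : ∃ C : ℝ, BilayerWallResidualFaultedCoreOnAt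
      (fun σ₁ σ₂ L₁ L₂ => ¬ EdgeOnAt (13 / 25) σ₁ σ₂ L₁ L₂ ∧ ¬ BarlowMenuSteer2WideRepCertified (13 / 25) σ₁ σ₂ L₁ L₂) (13 / 25) C 10) :
    ∃ C : ℝ, BilayerWallResidualFaultedCoreOnAt
      (fun σ₁ σ₂ L₁ L₂ => ¬ EdgeOnAt (13 / 25) σ₁ σ₂ L₁ L₂ ∧ ¬ BarlowMenuSteer2WideCertified (13 / 25) σ₁ σ₂ L₁ L₂) (13 / 25) C 10 :=
  residualFaultedCoreOnAt_of_repCut' hE1 hSP (by norm_num) (fun σ₁ σ₂ L₁ L₂ => ¬ EdgeOnAt (13 / 25) σ₁ σ₂ L₁ L₂) hrep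

/-- **The frozen `stub_edgeOn` from the represented stub**: `P5Exhaustion → StarPairFar → (∃ C, …CoreOnAt (EdgeOnAt (13/25) ∧ ¬RepCert (13/25)) (13/25) C 10)
→ ∃ C, BilayerWallResidualFaultedEdgeOnAt (13/25) C 10` (`edgeOn_of_steer2Cut` ∘ `edgeOnS_of_repCut`). -/
theorem edgeOn_of_repCut (hE1 : P5Exhaustion) (hSP : StarPairFar)
    (hrep : ∃ C : ℝ, BilayerWallResidualFaultedCoreOnAt
      (fun σ₁ σ₂ L₁ L₂ => EdgeOnAt (13 / 25) σ₁ σ₂ L₁ L₂ ∧ ¬ BarlowMenuSteer2WideRepCertified (13 / 25) σ₁ σ₂ L₁ L₂) (13 / 25) C 10) :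
    ∃ C : ℝ, BilayerWallResidualFaultedEdgeOnAt (13 / 25) C 10 :=
  edgeOn_of_steer2Cut hE1 hSP (edgeOnS_of_repCut hE1 hSP hrep)

/-- **`stub_residualFaultedCore` BY NAME from the semantic cut over the REPRESENTED menu at `(13/25, 10)`**: {E1, StarPairFar, the read holes of the
represented menu, the edge-on core of the represented menu}. -/
theorem stub_residualFaultedCore_of_semanticCutSteer2WideRep (hE1 : P5Exhaustion) (hSP : StarPairFar)
    (hholes : ∃ C : ℝ, BilayerWallResidualFaultedCoreOnAt
      (fun σ₁ σ₂ L₁ L₂ => ¬ EdgeOnAt (13 / 25) σ₁ σ₂ L₁ L₂ ∧ ¬ BarlowMenuSteer2WideRepCertified (13 / 25) σ₁ σ₂ L₁ L₂) (13 / 25) C 10)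
    (hrep : ∃ C : ℝ, BilayerWallResidualFaultedCoreOnAt
      (fun σ₁ σ₂ L₁ L₂ => EdgeOnAt (13 / 25) σ₁ σ₂ L₁ L₂ ∧ ¬ BarlowMenuSteer2WideRepCertified (13 / 25) σ₁ σ₂ L₁ L₂) (13 / 25) C 10) :
    ∃ C : ℝ, BilayerWallResidualFaultedCoreAt (13 / 25) C 10 :=
  stub_residualFaultedCore_of_semanticCutSteer2Wide hE1 hSP (readHoles₂_of_repCut hE1 hSP hholes) (edgeOnS_of_repCut hE1 hSP hrep)

/-! ## Monotonicity (v8.6/v8.7 → v8.8) -/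

/-- **The shrunken edge-on core implies the represented one**: the core on `EdgeOnAt c₀ ∧ ¬Cert₂` gives the core on `EdgeOnAt c₀ ∧ ¬RepCert`. -/
theorem residualFaultedCoreOnAt_edgeOnRep_of_edgeOnS {c₀ C R₀ : ℝ}
    (h : BilayerWallResidualFaultedCoreOnAt
      (fun σ₁ σ₂ L₁ L₂ => EdgeOnAt c₀ σ₁ σ₂ L₁ L₂ ∧ ¬ BarlowMenuSteer2WideCertified c₀ σ₁ σ₂ L₁ L₂) c₀ C R₀) :
    BilayerWallResidualFaultedCoreOnAt
      (fun σ₁ σ₂ L₁ L₂ => EdgeOnAt c₀ σ₁ σ₂ L₁ L₂ ∧ ¬ BarlowMenuSteer2WideRepCertified c₀ σ₁ σ₂ L₁ L₂) c₀ C R₀ :=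
  residualFaultedCoreOnAt_anti (fun _ _ _ _ hx => ⟨hx.1, fun hw => hx.2 (Or.inl hw)⟩) h

/-- The frozen `stub_edgeOn` implies the represented edge-on core. -/
theorem residualFaultedCoreOnAt_edgeOnRep_of_edgeOn {c₀ C R₀ : ℝ} (h : BilayerWallResidualFaultedEdgeOnAt c₀ C R₀) :
    BilayerWallResidualFaultedCoreOnAt
      (fun σ₁ σ₂ L₁ L₂ => EdgeOnAt c₀ σ₁ σ₂ L₁ L₂ ∧ ¬ BarlowMenuSteer2WideRepCertified c₀ σ₁ σ₂ L₁ L₂) c₀ C R₀ :=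
  residualFaultedCoreOnAt_edgeOnRep_of_edgeOnS (residualFaultedCoreOnAt_edgeOnS_of_edgeOn h)

/-- **The two-sided-menu read holes contain the represented-menu read holes.** -/
theorem residualFaultedCoreOnAt_repHoles_of_steer2Holes {c₀ C R₀ : ℝ}
    (h : BilayerWallResidualFaultedCoreOnAt
      (fun σ₁ σ₂ L₁ L₂ => ¬ EdgeOnAt c₀ σ₁ σ₂ L₁ L₂ ∧ ¬ BarlowMenuSteer2WideCertified c₀ σ₁ σ₂ L₁ L₂) c₀ C R₀) :
    BilayerWallResidualFaultedCoreOnAt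
      (fun σ₁ σ₂ L₁ L₂ => ¬ EdgeOnAt c₀ σ₁ σ₂ L₁ L₂ ∧ ¬ BarlowMenuSteer2WideRepCertified c₀ σ₁ σ₂ L₁ L₂) c₀ C R₀ :=
  residualFaultedCoreOnAt_anti (fun _ _ _ _ hx => ⟨hx.1, fun hw => hx.2 (Or.inl hw)⟩) h

/-! ## The geometry: no plate is steep in both presentations (19480-p1 g15's 60° covering) -/

/-- **The twin re-presentation frame is 19480-p1's twin presentation** `(basalMirror ≫ (−id)) ≫ L` (`…SteepPlateTwin`, p710208): `R = −M`. -/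
theorem twinRepFrame_eq_twinPresentation (L : E3 ≃ₗᵢ[ℝ] E3) :
    twinRepFrame L = (basalMirror.trans (LinearIsometryEquiv.neg ℝ)).trans L := by
  ext x : 1
  rw [twinRepFrame_apply, twinRot_eq_neg_basalMirror]
  simp only [LinearIsometryEquiv.trans_apply, LinearIsometryEquiv.coe_neg]

/-- **No plate is steep toward `e` in BOTH presentations** (`steerSteepCos c ≤ 1/2`, `‖e‖ = 1`): if `(L, ·)` is steep toward `e` then its twin
re-presentation `(twinRepFrame L, ·)` is not — 19480-p1's `not_steepPlateAt_twin_of_steepPlateAt` (the six slot/capper directions cover the half-sphere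
at `60°`, `…SteepPlateTwin`) transported along `twinRepFrame_eq_twinPresentation`.  No hemisphere hypothesis: `SteepPlateAt` reads through the
up-presentation. -/
theorem not_steepPlateAt_rep {c : ℝ} (hc : steerSteepCos c ≤ 1 / 2) (L : E3 ≃ₗᵢ[ℝ] E3) {e : E3} (he : ‖e‖ = 1) :
    ¬ SteepPlateAt c L e ∨ ¬ SteepPlateAt c (twinRepFrame L) e := by
  by_cases h : SteepPlateAt c L e
  · right
    rw [twinRepFrame_eq_twinPresentation]
    exact not_steepPlateAt_twin_of_steepPlateAt hc he h
  · exact Or.inl h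

/-- The same read from the twin side: if the twin re-presentation is steep toward `e` then the original presentation is not. -/
theorem not_steepPlateAt_of_steepPlateAt_twinRep {c : ℝ} (hc : steerSteepCos c ≤ 1 / 2) {L : E3 ≃ₗᵢ[ℝ] E3} {e : E3} (he : ‖e‖ = 1)
    (h : SteepPlateAt c (twinRepFrame L) e) : ¬ SteepPlateAt c L e := by
  rcases not_steepPlateAt_rep hc (twinRepFrame L) he with h' | h'
  · exact absurd h h'
  · rwa [twinRepFrame_twinRepFrame] at h'

/-- **The chord of record**: at chord `1/3` (`steerSteepCos (1/3) = (17√2 − √70)/36 < 1/2`) no plate is steep toward a unit `e` in both presentations. -/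
theorem not_steepPlateAt_rep_third (L : E3 ≃ₗᵢ[ℝ] E3) {e : E3} (he : ‖e‖ = 1) :
    ¬ SteepPlateAt (1 / 3) L e ∨ ¬ SteepPlateAt (1 / 3) (twinRepFrame L) e :=
  not_steepPlateAt_rep steerSteepCos_third_lt_half.le L he

/-- Plate 1 toward `e₃`: not steep in some presentation (chord `1/3`). -/
theorem not_steepPlateAt_rep_third_e₃ (L : E3 ≃ₗᵢ[ℝ] E3) :
    ¬ SteepPlateAt (1 / 3) L e₃ ∨ ¬ SteepPlateAt (1 / 3) (twinRepFrame L) e₃ :=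
  not_steepPlateAt_rep_third L norm_e₃_eq_one

/-- Plate 2 toward `−e₃`: not steep in some presentation (chord `1/3`). -/
theorem not_steepPlateAt_rep_third_neg_e₃ (L : E3 ≃ₗᵢ[ℝ] E3) :
    ¬ SteepPlateAt (1 / 3) L (-e₃) ∨ ¬ SteepPlateAt (1 / 3) (twinRepFrame L) (-e₃) :=
  not_steepPlateAt_rep_third L (by rw [norm_neg, norm_e₃_eq_one])

/-! ## The represented corner has NO steep term: an uncertified pair launches in some presentation pair with a failing pair clause -/

/-- **Some presentation pair is not steep and not certified.**  If the pair is certified in NONE of the four presentation pairs then — choosing for each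
plate a presentation that is not steep toward the wall (`not_steepPlateAt_rep_third_e₃` / `_neg_e₃`) — there is a presentation pair `(F₁, τ₁), (F₂, τ₂)`,
`(F_i, τ_i) ∈ {(L_i, σ_i), (twinRepFrame L_i, −σ_i)}`, which is NOT a steep pair at chord `1/3` and is not `BarlowMenuSteer2WideCertified c₀`. -/
theorem exists_rep_not_steepPairAt_not_certified {c₀ : ℝ} {σ₁ σ₂ : ℤ → ℤ} {L₁ L₂ : E3 ≃ₗᵢ[ℝ] E3}
    (h : ¬ BarlowMenuSteer2WideRepCertified c₀ σ₁ σ₂ L₁ L₂) :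
    ∃ (τ₁ τ₂ : ℤ → ℤ) (F₁ F₂ : E3 ≃ₗᵢ[ℝ] E3),
      ((F₁ = L₁ ∧ τ₁ = σ₁) ∨ (F₁ = twinRepFrame L₁ ∧ τ₁ = fun n => -σ₁ n)) ∧
      ((F₂ = L₂ ∧ τ₂ = σ₂) ∨ (F₂ = twinRepFrame L₂ ∧ τ₂ = fun n => -σ₂ n)) ∧
      ¬ SteepPairAt (1 / 3) τ₁ τ₂ F₁ F₂ ∧ ¬ BarlowMenuSteer2WideCertified c₀ τ₁ τ₂ F₁ F₂ := by
  simp only [BarlowMenuSteer2WideRepCertified, not_or] at h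
  obtain ⟨h₀₀, h₁₀, h₀₁, h₁₁⟩ := h
  rcases not_steepPlateAt_rep_third_e₃ L₁ with hs₁ | hs₁ <;>
    rcases not_steepPlateAt_rep_third_neg_e₃ L₂ with hs₂ | hs₂
  · exact ⟨σ₁, σ₂, L₁, L₂, Or.inl ⟨rfl, rfl⟩, Or.inl ⟨rfl, rfl⟩, fun hp => hp.elim hs₁ hs₂, h₀₀⟩
  · exact ⟨σ₁, _, L₁, _, Or.inl ⟨rfl, rfl⟩, Or.inr ⟨rfl, rfl⟩, fun hp => hp.elim hs₁ hs₂, h₀₁⟩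
  · exact ⟨_, σ₂, _, L₂, Or.inr ⟨rfl, rfl⟩, Or.inl ⟨rfl, rfl⟩, fun hp => hp.elim hs₁ hs₂, h₁₀⟩
  · exact ⟨_, _, _, _, Or.inr ⟨rfl, rfl⟩, Or.inr ⟨rfl, rfl⟩, fun hp => hp.elim hs₁ hs₂, h₁₁⟩

/-- **THE REPRESENTED CORNER DICHOTOMY HAS NO STEEP BRANCH** (19480-p1 g15's corollary, typed): a pair certified in none of the four presentation pairs
has a presentation pair `(F₁, τ₁), (F₂, τ₂)` of the same two plates (`stacking F_i s τ_i = stacking L_i s σ_i` by `stacking_twinRep`) in which BOTH plates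
launch steered families at chord `1/3` (`SteerLaunchAt`) and one of the PAIR clauses fails: the two-sided flux sum, a frame clause (i)/(ii) («read»), or
(iii)_z («sep»).  What is left of the EDGE-ON regime under the represented menu is therefore sep / read / flux-sum, never «steep». -/
theorem launches_with_failing_pairClause_of_not_repCertified {c₀ : ℝ} {σ₁ σ₂ : ℤ → ℤ} {L₁ L₂ : E3 ≃ₗᵢ[ℝ] E3}
    (h : ¬ BarlowMenuSteer2WideRepCertified c₀ σ₁ σ₂ L₁ L₂) :
    ∃ (τ₁ τ₂ : ℤ → ℤ) (F₁ F₂ : E3 ≃ₗᵢ[ℝ] E3),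
      ((F₁ = L₁ ∧ τ₁ = σ₁) ∨ (F₁ = twinRepFrame L₁ ∧ τ₁ = fun n => -σ₁ n)) ∧
      ((F₂ = L₂ ∧ τ₂ = σ₂) ∨ (F₂ = twinRepFrame L₂ ∧ τ₂ = fun n => -σ₂ n)) ∧
      ∃ z₁ v₁ z₂ v₂ : E3, SteerLaunchAt (1 / 3) F₁ τ₁ e₃ z₁ v₁ ∧ SteerLaunchAt (1 / 3) F₂ τ₂ (-e₃) z₂ v₂ ∧
        ¬ ((∀ i j : ℤ, Real.sqrt 2 * c₀ ≤
              steerRise (upFrame F₁ e₃) (upWord F₁ τ₁ e₃) e₃ z₁ v₁ i + steerRise (upFrame F₂ (-e₃)) (upWord F₂ τ₂ (-e₃)) (-e₃) z₂ v₂ j) ∧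
          (∀ F ∈ chainFrames z₁ (upFrame F₁ e₃) v₁,
              F '' fccStacking 1 (Real.sqrt (2 / 3)) ≠ F₂ '' fccStacking 1 (Real.sqrt (2 / 3)) ∧
              F '' fccStacking 1 (Real.sqrt (2 / 3)) ≠ (twinFrame F₂ (F₂ e₃)) '' fccStacking 1 (Real.sqrt (2 / 3))) ∧
          (∀ F ∈ chainFrames z₂ (upFrame F₂ (-e₃)) v₂,
              F '' fccStacking 1 (Real.sqrt (2 / 3)) ≠ F₁ '' fccStacking 1 (Real.sqrt (2 / 3)) ∧
              F '' fccStacking 1 (Real.sqrt (2 / 3)) ≠ (twinFrame F₁ (F₁ e₃)) '' fccStacking 1 (Real.sqrt (2 / 3))) ∧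
          (∀ G₁ ∈ chainFrames z₁ (upFrame F₁ e₃) v₁, ∀ G₂ ∈ chainFrames z₂ (upFrame F₂ (-e₃)) v₂, ¬ CoAxFrames G₁ G₂)) := by
  obtain ⟨τ₁, τ₂, F₁, F₂, hF₁, hF₂, hns, hnc⟩ := exists_rep_not_steepPairAt_not_certified h
  refine ⟨τ₁, τ₂, F₁, F₂, hF₁, hF₂, ?_⟩
  rcases steepPairAt_or_pairClauseFails_of_not_menuCertified hnc with hs | hl
  · exact absurd hs hns
  · exact hl

/-- The presentations named in the two theorems above present the same plates with the same origins. -/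
theorem stacking_of_rep_choice {σ τ : ℤ → ℤ} {L F : E3 ≃ₗᵢ[ℝ] E3}
    (hF : (F = L ∧ τ = σ) ∨ (F = twinRepFrame L ∧ τ = fun n => -σ n)) (s : E3) : stacking F s τ = stacking L s σ := by
  rcases hF with ⟨rfl, rfl⟩ | ⟨rfl, rfl⟩
  · rfl
  · exact stacking_twinRep L s σ

end Summit.Ventures.Crystal3D.Cruxes.TextureLiminf.TexShadow

end
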